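import Summits.Ventures.PercRepro.S1SevenFiveRankTwoParts

/-!
# PercRepro — THE `(4, 3)` SPLIT AT `(7, 4)`: A SIMPLE COLOOP-FREE RANK-4 PART ON 7 POINTS ⊕ A SIMPLE COLOOP-FREE
RANK-3 PART ON 5 POINTS (p2, gen 28; SUBCLAIM-S1 §6.10 (xvii)(m))

`#U ≤ N_M(4, 2) N_N(3, 2) + N_M(4, 3) N_N(3, 1) ≤ 35 · 10 + 35 · 5 = 525`, so `Φ(7, 4) · #U ≤ 1470`, and
`#Y ≥ f_M(2) f_N(3) + f_M(3) (f_N(2) + f_N(3)) + f_M(4) (f_N(1) + f_N(2)) ≥ 21 · 13 + 23 f_M(3) + 15 f_M(4) ≥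
273 + 15 · 78 + 8 · 21 = 1611`. Nothing is claimed about any cell.

* `c025_seven_four_disjointSum_four_three`.
Axioms: standard.
-/

open scoped Matroid

namespace PercRepro

namespace S1

open Set

variable {α : Type}

/-- The arithmetic of the `(4, 3)`-split consumer at `(7, 4)`. -/
theorem consumer_arith_four_three_seven {u y : ℚ} (hU : u ≤ 525) (hY : 1611 ≤ y) : 14 / 5 * u ≤ y := by
  linarith

/-- **The `(4, 3)`-split consumer at `(7, 4)`**: `M` coloop-free of rank `4` on `7` points and `N` coloop-free of
rank `3` on `5` points, both with all pairs of rank `2`. -/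
theorem c025_seven_four_disjointSum_four_three (M N : Matroid α) [M.Finite] [N.Finite] (h : Disjoint M.E N.E)
    (hM : M.eRank = ((4 : ℕ) : ℕ∞)) (hME : M.E.ncard = 7) (hcolM : M.coloops = ∅)
    (hpairsM : ∀ e ∈ M.E, ∀ f ∈ M.E, e ≠ f → M.eRk {e, f} = 2) (hN : N.eRank = ((3 : ℕ) : ℕ∞))
    (hNE : N.E.ncard = 5) (hcolN : N.coloops = ∅) (hpairsN : ∀ e ∈ N.E, ∀ f ∈ N.E, e ≠ f → N.eRk {e, f} = 2) :
    phiK 7 4 * ({A : Set α | A ⊆ (M.disjointSum N h).E ∧ (M.disjointSum N h).eRk A = ((7 : ℕ) : ℕ∞) ∧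
        (M.disjointSum N h).eRk ((M.disjointSum N h).E \ A) = ((4 : ℕ) : ℕ∞)}.ncard : ℚ) ≤
      ({A : Set α | A ⊆ (M.disjointSum N h).E ∧ ((4 : ℕ) : ℕ∞) < (M.disjointSum N h).eRk A ∧
        (M.disjointSum N h).eRk A < ((7 : ℕ) : ℕ∞)}.ncard : ℚ) := by
  obtain ⟨hF3, hT⟩ := ncard_rankSet_three_ge_rank_four_seven M hM hME hcolM hpairsM
  -- the `U`-side
  have hU : {A : Set α | A ⊆ (M.disjointSum N h).E ∧ (M.disjointSum N h).eRk A = ((7 : ℕ) : ℕ∞) ∧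
      (M.disjointSum N h).eRk ((M.disjointSum N h).E \ A) = ((4 : ℕ) : ℕ∞)}.ncard ≤ 525 := by
    rw [disjointSum_ncard_U_eq_finsum M N h 7 4, finsum_mem_coe_finset]
    rw [Finset.sum_eq_add_of_mem (4, 2) (4, 3) (by decide) (by decide) (by decide) ?_]
    · dsimp only
      show (profileSet M 4 2).ncard * (profileSet N 3 2).ncard + (profileSet M 4 3).ncard * (profileSet N 3 1).ncard ≤ _
      have h42 := ncard_profileSet_four_two_le_add_triples M hME
      have h42' : (profileSet M 4 2).ncard ≤ 35 := by omega
      have h43 := ncard_profileSet_le_choose_of_ncard_eq (N := M) (a := 4) (b := 3) hME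
      rw [show Nat.choose (4 + 3) 4 = 35 by decide] at h43
      have g32 := ncard_profileSet_le_choose_of_ncard_eq (N := N) (a := 3) (b := 2) hNE
      rw [show Nat.choose (3 + 2) 3 = 10 by decide] at g32
      have g31 := ncard_profileSet_top_one_le_of_pairs' hpairsN 3
      rw [hNE] at g31
      calc (profileSet M 4 2).ncard * (profileSet N 3 2).ncard + (profileSet M 4 3).ncard * (profileSet N 3 1).ncard
          ≤ 35 * 10 + 35 * 5 := Nat.add_le_add (Nat.mul_le_mul h42' g32) (Nat.mul_le_mul h43 g31)
        _ = 525 := by norm_num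
    · rintro ⟨a, b⟩ hmem ⟨hne1, hne2⟩
      rw [Finset.mem_product, Finset.mem_range, Finset.mem_range] at hmem
      dsimp only
      rcases Nat.lt_or_ge 4 a with ha | ha
      · rw [profileSet_eq_empty_of_eRank_lt M hM ha b, ncard_empty, zero_mul]
      rcases Nat.lt_or_ge a 4 with ha' | ha'
      · have h7a : 3 < 7 - a := by omega
        rw [profileSet_eq_empty_of_eRank_lt N hN h7a (4 - b), ncard_empty, mul_zero]
      have ha4 : a = 4 := by omega
      subst ha4
      rw [show (7 : ℕ) - 4 = 3 from rfl]
      rcases Nat.lt_or_ge b 2 with hb | hb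
      · have h5 : N.E.ncard < 3 + (4 - b) := by rw [hNE]; omega
        rw [profileSet_eq_empty_of_ncard_lt N h5, ncard_empty, mul_zero]
      · have hb4 : b = 4 := by
          rcases Nat.lt_or_ge b 4 with hb4 | hb4
          · exfalso
            rcases Nat.lt_or_ge b 3 with hb3 | hb3
            · exact hne1 (by congr 1; omega)
            · exact hne2 (by congr 1; omega)
          · omega
        subst hb4
        rw [profileSet_eq_empty_of_ncard_lt M (by rw [hME]; norm_num : M.E.ncard < 4 + 4), ncard_empty, zero_mul]
  -- the `Y`-side
  have hY : 1611 ≤ {A : Set α | A ⊆ (M.disjointSum N h).E ∧ ((4 : ℕ) : ℕ∞) < (M.disjointSum N h).eRk A ∧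
        (M.disjointSum N h).eRk A < ((7 : ℕ) : ℕ∞)}.ncard := by
    rw [disjointSum_ncard_Y_eq_finsum M N h 7 4, finsum_mem_coe_finset]
    have hsub : ({(2, 3), (3, 2), (3, 3), (4, 1), (4, 2)} : Finset (ℕ × ℕ)) ⊆
        (Finset.range 7 ×ˢ Finset.range 7).filter (fun x : ℕ × ℕ => 4 < x.1 + x.2 ∧ x.1 + x.2 < 7) := by
      decide
    refine le_trans ?_ (Finset.sum_le_sum_of_subset hsub)
    rw [Finset.sum_insert (by decide), Finset.sum_insert (by decide), Finset.sum_insert (by decide),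
      Finset.sum_insert (by decide), Finset.sum_singleton]
    dsimp only
    have hcl : ∀ x ∈ M.E, ∀ y ∈ M.E, x ≠ y → (M.closure {x, y}).ncard ≤ 4 := by
      intro x hx y hy hxy
      have := ncard_closure_pair_le_of_coloops' M hM (by norm_num) hcolM hpairsM hx hy hxy
      rw [hME] at this
      omega
    have hbig := ncard_bigRankTwo_le_choose M hpairsM hcl
    rw [hME, show Nat.choose 7 2 = 21 by decide] at hbig
    have hF2hi := ncard_rankSet_two_le_add_big M
    rw [hME, show Nat.choose 7 2 = 21 by decide] at hF2hi
    have hF234 := ncard_rankSet_two_three_four_ge_of_pairs M hM hpairsM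
    rw [hME, show 2 ^ 7 - 1 - 7 = 120 by decide] at hF234
    have hG : 78 ≤ (rankSet M 3).ncard + (rankSet M 4).ncard := by omega
    have F2 : 21 ≤ (rankSet M 2).ncard := by
      have := choose_le_ncard_rankSet_two_of_pairs hpairsM
      rwa [hME, show Nat.choose 7 2 = 21 by decide] at this
    have G1 : 5 ≤ (rankSet N 1).ncard := by
      have := ncard_le_ncard_rankSet_one_of_pairs hpairsN (by omega)
      rwa [hNE] at this
    have G2 : 10 ≤ (rankSet N 2).ncard := by
      have := choose_le_ncard_rankSet_two_of_pairs hpairsN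
      rwa [hNE, show Nat.choose 5 2 = 10 by decide] at this
    have G3 := ncard_rankSet_three_ge_rank_three_five N hN hNE hcolN hpairsN
    have e23 := Nat.mul_le_mul F2 G3
    have e32 := Nat.mul_le_mul_left (rankSet M 3).ncard G2
    have e33 := Nat.mul_le_mul_left (rankSet M 3).ncard G3
    have e41 := Nat.mul_le_mul_left (rankSet M 4).ncard G1
    have e42 := Nat.mul_le_mul_left (rankSet M 4).ncard G2
    nlinarith [e23, e32, e33, e41, e42, hG, hF3]
  rw [phiK_seven_four]
  have hU' : (({A : Set α | A ⊆ (M.disjointSum N h).E ∧ (M.disjointSum N h).eRk A = ((7 : ℕ) : ℕ∞) ∧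
      (M.disjointSum N h).eRk ((M.disjointSum N h).E \ A) = ((4 : ℕ) : ℕ∞)}.ncard : ℕ) : ℚ) ≤ 525 := by
    exact_mod_cast hU
  have hY' : (1611 : ℚ) ≤ (({A : Set α | A ⊆ (M.disjointSum N h).E ∧ ((4 : ℕ) : ℕ∞) < (M.disjointSum N h).eRk A ∧
        (M.disjointSum N h).eRk A < ((7 : ℕ) : ℕ∞)}.ncard : ℕ) : ℚ) := by
    exact_mod_cast hY
  exact consumer_arith_four_three_seven hU' hY'

end S1

end PercRepro
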